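import Literature.Geometry.Kaehler.CyclotomicDegreeLeTenHodgeConjecture
import Literature.Geometry.Kaehler.CyclotomicTwentySixHodgeConjecture
import HarnessLib

/-!
# Cyclotomic fields of degree `≤ 12` other than `ℚ(ζ₂₁) = ℚ(ζ₄₂)`, `ℚ(ζ₂₈)`, `ℚ(ζ₃₆)`: every abelian variety with complex multiplication by `ℚ(ζ_d)`,
# ANY CM type, satisfies the Hodge conjecture with all its powers; every complex torus with `P_u = Φ_d` has `Hdg = Div` on all powers

Layer `Literature/Geometry/Kaehler`, namespace `Literature.Geometry.Kaehler.ComplexTorus`; lane `lit-hodgefound` (Track 2 foundations library), prover seat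
`lit-hodgefound-p10`, generation 33, row «A2-26(hu)» (self-proposed 2026-08-28) — the closing statement of the generation.  Theorems only; no `def`, no
instance, no named fact (net Literature debt 0).

`φ(d) = 12 ⟺ d ∈ {13, 21, 26, 28, 36, 42}` (§1, from `φ(p^k) = p^{k-1}(p-1) ∣ 12`, so `d ∣ 2³·3²·5·7·13 = 32760`, and an inspection of the divisors by
kernel decision).  For `d ∈ {13, 26}` every CM type of `ℚ(ζ_d) = ℚ(ζ₁₃)` is stably nondegenerate (`CyclotomicThirteenHodgeConjecture`,
`CyclotomicTwentySixHodgeConjecture`); for `φ(d) ≤ 10` this is `CyclotomicDegreeLeTenHodgeConjecture`.  The fields `ℚ(ζ₂₁) = ℚ(ζ₄₂)`, `ℚ(ζ₂₈)`,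
`ℚ(ζ₃₆)` are EXCLUDED, and must be: they carry degenerate PRIMITIVE CM types (rank `6 < 7`), whose simple abelian sixfolds have exceptional Hodge
classes on some power (the tree's `Pohlmann1968/DegenerateCMTypeCyclotomic21`; Hazama's criterion) — there the Hodge conjecture is a genuine question,
not a consequence of `Hdg = Div`.

* §1 `dvd_of_totient_eq_twelve`, `eq_of_totient_eq_twelve`, `totient_eq_twelve_iff`.
* §2 **`hodgeClassSpan_pow_eq_and_hodgeConjectureFor_pow_of_totient_le_twelve`** (varieties: `K = ℚ(ζ_d)`, `d > 2`, `φ(d) ≤ 12`, `d ∉ {21, 28, 36, 42}`,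
  every CM type, every realisation, every power).
* §3 **`divisorClasses_powPeriod_eq_hodgeClasses_of_charpoly_eq_cyclotomic_of_totient_le_twelve`** (tori with `P_u = Φ_d`, same `d`), and the dimension
  form `…_of_finrank_le_six` (complex tori of dimension `≤ 6` with `P_u = Φ_d`, `d ∉ {21, 28, 36, 42}`).

## References

* [Washington1997] L. C. Washington, *Introduction to Cyclotomic Fields*, 2nd ed. (1997), Ch. 2 (`φ`, `[ℚ(ζ_n) : ℚ] = φ(n)`).
* [Shimura1998] G. Shimura (1998), §8.4 Example (1).
* [Gordon1999HodgeAVSurvey] B. B. Gordon (1999), Thm. 6.3, Thm. 6.4, 7.5, §9.3.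
* [MoonenZarhin1999LowDim] B. Moonen, Yu. Zarhin, Math. Ann. 315 (1999), Thm. 0.1.
* [Hazama2003CyclicCM] F. Hazama, J. Math. Sci. Univ. Tokyo 10 (2003), Thm. 4.9, Rem. 4.10.
-/

noncomputable section

open scoped Classical nonZeroDivisors NumberField Manifold ContDiff MatrixGroups
open NumberField Module Polynomial CategoryTheory CategoryTheory.Limits

namespace Literature.Geometry.Kaehler

namespace ComplexTorus

-- `open scoped`: the tree's action of `Aut(ℂ)` on `Hom(K, ℂ)` by composition (`ringEquivCompAction`) is a scoped instance
open scoped Literature.NumberTheory.ComplexMultiplication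
open Literature.AlgebraicGeometry.Motives (CMType AbelianVariety)
open Literature.AlgebraicGeometry.HodgeTheory (HodgeConjectureFor complexBetti)
open Literature.AlgebraicGeometry.VanGeemen1994 (hodgeClassSpan)
open Literature.Barriers.HodgeConjecture (divisorClassesSpan)
open Literature.AlgebraicGeometry.ComplexMultiplication (IsCMTypeRealisation)

/-! ### §1 `φ(d) = 12` -/

/-- **`φ(d) = 12 ⟹ d ∣ 32760 = 2³·3²·5·7·13`**: for each prime power `p^k ∥ d`, `φ(p^k) = p^{k-1}(p-1) ∣ φ(d) = 12`, whence `p ∈ {2, 3, 5, 7, 13}` with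
`k ≤ 3, 2, 1, 1, 1`. [cite: Washington1997, Ch. 2] [folklore] -/
theorem dvd_of_totient_eq_twelve {d : ℕ} (h : Nat.totient d = 12) : d ∣ 32760 := by
  have hd0 : d ≠ 0 := by rintro rfl; simp at h
  rw [← Nat.factorization_le_iff_dvd hd0 (by norm_num), Finsupp.le_def]
  intro p
  by_cases hp : p.Prime
  swap
  · rw [Nat.factorization_eq_zero_of_not_prime d hp]; exact Nat.zero_le _
  set k := d.factorization p with hk
  rcases Nat.eq_zero_or_pos k with hk0 | hkpos
  · rw [hk0]; exact Nat.zero_le _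
  have hpk : p ^ k ∣ d := Nat.ordProj_dvd d p
  have hφ : p ^ (k - 1) * (p - 1) ∣ 12 := by
    rw [← Nat.totient_prime_pow hp hkpos, ← h]; exact Nat.totient_dvd_of_dvd hpk
  have hp1 : p - 1 ∣ 12 := (Dvd.intro_left _ rfl).trans hφ
  have hp13 : p ≤ 13 := by have := Nat.le_of_dvd (by norm_num) hp1; omega
  have hpow : p ^ (k - 1) ∣ 12 := (Dvd.intro _ rfl).trans hφ
  rw [← hp.pow_dvd_iff_le_factorization (by norm_num)]
  have h2 := hp.two_le
  interval_cases p
  · -- p = 2 : k ≤ 3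
    have hk3 : k ≤ 3 := by
      by_contra hc
      have h8 : (2 : ℕ) ^ 3 ∣ 12 := (pow_dvd_pow 2 (show 3 ≤ k - 1 by omega)).trans hpow
      norm_num at h8
    exact (pow_dvd_pow 2 hk3).trans (by norm_num)
  · -- p = 3 : k ≤ 2
    have hk2 : k ≤ 2 := by
      by_contra hc
      have h9 : (3 : ℕ) ^ 2 ∣ 12 := (pow_dvd_pow 3 (show 2 ≤ k - 1 by omega)).trans hpow
      norm_num at h9
    exact (pow_dvd_pow 3 hk2).trans (by norm_num)
  · exact absurd hp (by norm_num)
  · -- p = 5 : k = 1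
    have hk1 : k = 1 := by
      by_contra hc
      have h5 : (5 : ℕ) ^ 1 ∣ 12 := (pow_dvd_pow 5 (show 1 ≤ k - 1 by omega)).trans hpow
      norm_num at h5
    rw [hk1]; norm_num
  · exact absurd hp (by norm_num)
  · -- p = 7 : k = 1
    have hk1 : k = 1 := by
      by_contra hc
      have h7 : (7 : ℕ) ^ 1 ∣ 12 := (pow_dvd_pow 7 (show 1 ≤ k - 1 by omega)).trans hpow
      norm_num at h7
    rw [hk1]; norm_num
  · exact absurd hp (by norm_num)
  · exact absurd hp (by norm_num)
  · exact absurd hp (by norm_num)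
  · -- p = 11 : `10 ∣ 12`, impossible
    omega
  · exact absurd hp (by norm_num)
  · -- p = 13 : k = 1
    have hk1 : k = 1 := by
      by_contra hc
      have h13 : (13 : ℕ) ^ 1 ∣ 12 := (pow_dvd_pow 13 (show 1 ≤ k - 1 by omega)).trans hpow
      norm_num at h13
    rw [hk1]; norm_num

set_option maxRecDepth 100000 in
/-- **`φ(d) = 12 ⟹ d ∈ {13, 21, 26, 28, 36, 42}`** (inspection of the `96` divisors of `32760`, by kernel decision). [cite: Washington1997, Ch. 2] [folklore] -/
theorem eq_of_totient_eq_twelve {d : ℕ} (h : Nat.totient d = 12) : d = 13 ∨ d = 21 ∨ d = 26 ∨ d = 28 ∨ d = 36 ∨ d = 42 := by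
  have hmem : d ∈ Nat.divisors 32760 := Nat.mem_divisors.2 ⟨dvd_of_totient_eq_twelve h, by norm_num⟩
  have key : ∀ x ∈ Nat.divisors 32760, Nat.totient x = 12 → x = 13 ∨ x = 21 ∨ x = 26 ∨ x = 28 ∨ x = 36 ∨ x = 42 := by
    decide +kernel
  exact key d hmem h

/-- **`φ(d) = 12 ⟺ d ∈ {13, 21, 26, 28, 36, 42}`.** [cite: Washington1997, Ch. 2] [folklore] -/
theorem totient_eq_twelve_iff {d : ℕ} : Nat.totient d = 12 ↔ d = 13 ∨ d = 21 ∨ d = 26 ∨ d = 28 ∨ d = 36 ∨ d = 42 := by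
  refine ⟨eq_of_totient_eq_twelve, ?_⟩
  rintro (rfl | rfl | rfl | rfl | rfl | rfl) <;> decide

/-- `d > 2`, `φ(d) ≤ 12`, `d ∉ {21, 28, 36, 42}` ⟹ `φ(d) ≤ 10` or `d = 13` or `d = 26`. [folklore] -/
private theorem totient_le_ten_or_eq_of_totient_le_twelve {d : ℕ} (hd : 2 < d) (h12 : Nat.totient d ≤ 12)
    (hex : d ≠ 21 ∧ d ≠ 28 ∧ d ≠ 36 ∧ d ≠ 42) : Nat.totient d ≤ 10 ∨ d = 13 ∨ d = 26 := by
  by_cases h10 : Nat.totient d ≤ 10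
  · exact Or.inl h10
  · have h12' : Nat.totient d = 12 := by
      obtain ⟨r, hr⟩ := Nat.totient_even hd
      omega
    rcases eq_of_totient_eq_twelve h12' with h | h | h | h | h | h
    · exact Or.inr (Or.inl h)
    · exact absurd h hex.1
    · exact Or.inr (Or.inr h)
    · exact absurd h hex.2.1
    · exact absurd h hex.2.2.1
    · exact absurd h hex.2.2.2

/-! ### §2 Varieties -/

section Varieties

variable {d : ℕ} {K : Type} [Field K] [NumberField K]
  {A : AbelianVariety ℂ} {ι : 𝓞 K →+* End A} {θ : K →+* Module.End ℂ (complexBetti A.X 1)}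

/-- **`B•(Aⁿ) ⊗ ℂ = D•(Aⁿ) ⊗ ℂ` AND THE HODGE CONJECTURE FOR EVERY POWER OF EVERY ABELIAN VARIETY WITH COMPLEX MULTIPLICATION BY A CYCLOTOMIC FIELD `ℚ(ζ_d)` OF
DEGREE `≤ 12`, `d ∉ {21, 28, 36, 42}`, ANY CM TYPE.** [cite: Gordon1999HodgeAVSurvey, Thm. 6.3, Thm. 6.4 and §9.3] [cite: Shimura1998, §8.4 Example (1)]
[cite: Hazama2003CyclicCM, Thm. 4.9] -/
theorem hodgeClassSpan_pow_eq_and_hodgeConjectureFor_pow_of_totient_le_twelve (hK : IsCyclotomicExtension {d} ℚ K) (hd : 2 < d)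
    (h12 : Nat.totient d ≤ 12) (hex : d ≠ 21 ∧ d ≠ 28 ∧ d ≠ 36 ∧ d ≠ 42) (Φ : CMType K) (hA : IsCMTypeRealisation Φ A ι θ) (n k : ℕ) :
    hodgeClassSpan (⨁ fun _ : Fin n => A).dim (⨁ fun _ : Fin n => A).X k =
        divisorClassesSpan (⨁ fun _ : Fin n => A).X (⨁ fun _ : Fin n => A).dim k ∧
      HodgeConjectureFor (⨁ fun _ : Fin n => A).dim (⨁ fun _ : Fin n => A).X := by
  rcases totient_le_ten_or_eq_of_totient_le_twelve hd h12 hex with h10 | rfl | rfl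
  · exact hodgeClassSpan_pow_eq_and_hodgeConjectureFor_pow_of_totient_le_ten hK hd h10 Φ hA n k
  · exact ⟨hodgeClassSpan_pow_eq_divisorClassesSpan_thirteen hK Φ hA n k, hodgeConjectureFor_pow_thirteen hK Φ hA n⟩
  · have hK' := isCyclotomicExtension_thirteen_of_twentySix hK
    exact ⟨hodgeClassSpan_pow_eq_divisorClassesSpan_thirteen hK' Φ hA n k, hodgeConjectureFor_pow_thirteen hK' Φ hA n⟩

end Varieties

/-! ### §3 Complex tori with `P_u = Φ_d`, `φ(d) ≤ 12`, `d ∉ {21, 28, 36, 42}` -/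

section Tori

variable {ι : Type} [Fintype ι] [DecidableEq ι] {E : Type} [NormedAddCommGroup E] [NormedSpace ℂ E]
  {P : (ι → ℝ) ≃L[ℝ] E} {d : ℕ}

/-- **`Hdg(Xᵏ) = Div(Xᵏ)` FOR ALL `k`, FOR EVERY COMPLEX TORUS WITH AN ENDOMORPHISM OF CHARACTERISTIC POLYNOMIAL `Φ_d`, `d > 2`, `φ(d) ≤ 12`, `d ∉ {21, 28, 36, 42}`**
(simple or not). [cite: MoonenZarhin1999LowDim, Thm. 0.1] [cite: Gordon1999HodgeAVSurvey, Thm. 6.3 (2), 7.5] [cite: Shimura1998, §8.4 Example (1)] -/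
theorem divisorClasses_powPeriod_eq_hodgeClasses_of_charpoly_eq_cyclotomic_of_totient_le_twelve (hd : 2 < d) (h12 : Nat.totient d ≤ 12)
    (hex : d ≠ 21 ∧ d ≠ 28 ∧ d ≠ 36 ∧ d ≠ 42) {A : Matrix ι ι ℤ} (hA : A ∈ endRingInt P) (hP : A.charpoly = cyclotomic d ℤ) (k p : ℕ) :
    divisorClasses (powPeriod P k) p = hodgeClasses (powPeriod P k) p := by
  rcases totient_le_ten_or_eq_of_totient_le_twelve hd h12 hex with h10 | rfl | rfl
  · exact divisorClasses_powPeriod_eq_hodgeClasses_of_charpoly_eq_cyclotomic_of_totient_le_ten hd h10 hA hP k p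
  · exact divisorClasses_powPeriod_eq_hodgeClasses_of_charpoly_eq_cyclotomic_thirteen hA hP k p
  · exact divisorClasses_powPeriod_eq_hodgeClasses_of_charpoly_eq_cyclotomic_twentySix hA hP k p

/-- **The same for complex tori of dimension `≤ 6`** (`2 dim X = φ(d)`) with an endomorphism of cyclotomic characteristic polynomial `Φ_d`, `d > 2`,
`d ∉ {21, 28, 36, 42}`. [cite: MoonenZarhin1999LowDim, Thm. 0.1] [cite: Shimura1998, §8.4 Example (1)] -/
theorem divisorClasses_powPeriod_eq_hodgeClasses_of_charpoly_eq_cyclotomic_of_finrank_le_six (hd : 2 < d) (h6 : finrank ℂ E ≤ 6)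
    (hex : d ≠ 21 ∧ d ≠ 28 ∧ d ≠ 36 ∧ d ≠ 42) {A : Matrix ι ι ℤ} (hA : A ∈ endRingInt P) (hP : A.charpoly = cyclotomic d ℤ) (k p : ℕ) :
    divisorClasses (powPeriod P k) p = hodgeClasses (powPeriod P k) p := by
  have h := two_mul_finrank_eq_totient_of_charpoly_eq_cyclotomic P hP
  exact divisorClasses_powPeriod_eq_hodgeClasses_of_charpoly_eq_cyclotomic_of_totient_le_twelve hd (by omega) hex hA hP k p

end Tori

end ComplexTorus

end Literature.Geometry.Kaehler

end
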